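import Literature.Topology.FourManifolds.CobordismEndFlattening
import HarnessLib

/-!
# Matching an arbitrary collar of an end of a cobordism to a reference collar

Topic `Literature/Topology/FourManifolds` (infrastructure for the uniqueness of cobordism
attachments `W ∪_ψ X`, Milnor, *Lectures on the h-cobordism theorem* (1965), Thm. 1.4,
uniqueness half, used by the fact seat of
`Literature.Barriers.SmoothPoincare4.akbulutRuberman2016_relativelyExotic`).  Everything here
is PROVED; no definitions, no named facts.

Let `X` be a cobordism from `M` to `N`, `C` an open collar of `∂X` and `κ = X.endCollar C` the
collar of the incoming end read off `C` (`CobordismAttachmentProofs.lean`).  Let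
`e : M × [0, ε) → X.W` be ANY other collar of the incoming end, given by explicit data: a map
`e : M × ℝ → X.W`, smooth on the slab `M × [0, ε)`, with `e (m, 0) = inl m`, taking the slab into
an open set `U` on which a smooth inverse `einv : U → M × [0, ε)` is given.  The main theorem
`Cobordism.exists_diffeomorph_comp_collar_eq_endCollar` produces a self-diffeomorphism `Ψ` of
`X.W` fixing BOTH ends pointwise with `Ψ ∘ e = κ` on a thinner slab `M × [0, δ)`; consequently
(`Cobordism.exists_diffeomorph_comp_collar_eq_collar`) any two such collars `e₁`, `e₂` are
matched by a diffeomorphism fixing the ends: `Ψ ∘ e₁ = e₂` near `M × {0}`.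

This is the **uniqueness of collars** (Bröcker–Jänich, *Introduction to Differential Topology*
(1982), (13.7): "the collar of a compact boundary is unique up to diffeotopy"; Hirsch,
*Differential Topology* (1976), Ch. 8 §1, Thm. 1.8; Munkres, *Elementary Differential Topology*
(1966), §6) in the ambient form needed to compare two gluings along the end, and it is proved
exactly as the special case `e = G ∘ κ` of `CobordismEndFlattening.lean`
(`Cobordism.exists_diffeomorph_flatten_inl`), whose §1 and §3 are reused verbatim:

* §1 a slab `M × [0, δ₁)` carried by `e` into the collar region of `κ` and by `κ` into `U`;
* §2 the **collar germ** `Γ = κ⁻¹ ∘ e` along `M × {0}` with inverse germ `einv ∘ κ` (a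
  `CollarGerm`, `CollarGerm.lean`, two-sided height by Seeley extension, `CylinderSeeley.lean`)
  and its extension `S` to the open half cylinder (`CollarGerm.exists_extension`,
  `CollarGermExtension.lean`): `S = Γ` near the bottom, `S = id` above a level;
* §3 `Ψ = κ ∘ S⁻¹ ∘ κ⁻¹` on the collar region of positive height, the identity elsewhere; near
  `inl M` it equals `κ ∘ einv` (smooth on the open `U`), on the open collar region it is a
  conjugate of `S⁻¹`, and off a compact piece of the collar it is the identity; and
  `Ψ (e (m, t)) = κ (m, t)` for `t < a₂`.

## References

* Th. Bröcker, K. Jänich, *Introduction to Differential Topology*, CUP (1982), (13.7).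
  [BrockerJanich1982]
* M. W. Hirsch, *Differential Topology*, GTM 33 (1976), Ch. 8 §1, Thm. 1.8–1.9. [HirschDT1976]
* J. Milnor, *Lectures on the h-cobordism theorem*, Princeton (1965), §1, Thm. 1.4.
  [MilnorHCobordism1965]
-/

open scoped Manifold ContDiff Topology
open Set Function

noncomputable section

namespace Literature.Topology.FourManifolds

universe u

namespace Cobordism

variable {n : ℕ} {M N : Type u} [TopologicalSpace M] [ChartedSpace (EuclideanSpace ℝ (Fin n)) M]
  [TopologicalSpace N] [ChartedSpace (EuclideanSpace ℝ (Fin n)) N] (X : Cobordism n M N)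

/-! ### §1 A slab adapted to both collars -/

section Slab

variable (C : X.bdry.OpenCollar) [CompactSpace M]
  {ε : ℝ} (hε : 0 < ε) {e : M × ℝ → X.W} {U : Set X.W} (hUo : IsOpen U)
  (he0 : ∀ m, e (m, 0) = X.inl m)
  (hes : ContMDiffOn ((𝓡 n).prod 𝓘(ℝ, ℝ)) (𝓡∂ (n + 1)) ∞ e (univ ×ˢ Ico 0 ε))
  (heU : MapsTo e (univ ×ˢ Ico (0 : ℝ) ε) U)

include hε hUo he0 hes heU in
/-- **A slab adapted to both collars.** There is `δ₁ ∈ (0, ε]` such that for `t ∈ [0, δ₁)` the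
point `e (m, t)` lies in the collar region of the reference collar over the incoming part and the
reference collar point `κ (m, t)` lies in the open set `U` of the second collar (compactness of
`M`, continuity, and `e (m, 0) = κ (m, 0) = inl m`). [folklore] -/
theorem exists_slab_collar :
    ∃ δ₁, 0 < δ₁ ∧ δ₁ ≤ ε ∧ ∀ m, ∀ t ∈ Ico 0 δ₁,
      e (m, t) ∈ C.regionOver X.inlPart ∧ X.endCollar C m t ∈ U := by
  have h1 : ContinuousOn (uncurry (X.endCollar C)) ((univ : Set M) ×ˢ Ico 0 ε) :=
    (X.continuousOn_endCollar C).mono (prod_mono Subset.rfl fun _ ht => ht.1)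
  have h2 : ContinuousOn e ((univ : Set M) ×ˢ Ico 0 ε) := hes.continuousOn
  have hg : ContinuousOn (fun q : M × ℝ => (e q, uncurry (X.endCollar C) q))
      ((univ : Set M) ×ˢ Ico 0 ε) := h2.prodMk h1
  have hV : IsOpen ((C.regionOver X.inlPart) ×ˢ U) :=
    (C.isOpen_regionOver _ X.isOpen_inlPart).prod hUo
  have h0 : ∀ m : M, (e (m, 0), uncurry (X.endCollar C) (m, 0)) ∈ (C.regionOver X.inlPart) ×ˢ U := by
    intro m
    have hm : X.inl m ∈ C.regionOver X.inlPart :=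
      C.incl_mem_regionOver X.inlPart (X.inlB_mem_inlPart m)
    refine ⟨?_, ?_⟩
    · change e (m, 0) ∈ _
      rw [he0 m]; exact hm
    · change X.endCollar C m 0 ∈ U
      rw [X.endCollar_zero, ← he0 m]
      exact heU ⟨mem_univ _, le_rfl, hε⟩
  obtain ⟨u, hu, huε, hmem⟩ := exists_forall_mem_of_continuousOn hε hg hV h0
  exact ⟨u, hu, huε, fun m t ht => hmem m t ht⟩

end Slab

/-! ### §2 The collar germ `κ⁻¹ ∘ e` and its extension -/

section Germ

variable (C : X.bdry.OpenCollar) [Nonempty M] [IsManifold (𝓡 n) ∞ M] [CompactSpace M]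
  {ε : ℝ} (hε : 0 < ε) {e : M × ℝ → X.W} {einv : X.W → M × ℝ} {U : Set X.W} (hUo : IsOpen U)
  (he0 : ∀ m, e (m, 0) = X.inl m)
  (hes : ContMDiffOn ((𝓡 n).prod 𝓘(ℝ, ℝ)) (𝓡∂ (n + 1)) ∞ e (univ ×ˢ Ico 0 ε))
  (heU : MapsTo e (univ ×ˢ Ico (0 : ℝ) ε) U)
  (hUe : ∀ z ∈ U, einv z ∈ (univ : Set M) ×ˢ Ico (0 : ℝ) ε ∧ e (einv z) = z)
  (hie : ∀ q ∈ (univ : Set M) ×ˢ Ico (0 : ℝ) ε, einv (e q) = q)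
  (his : ContMDiffOn (𝓡∂ (n + 1)) ((𝓡 n).prod 𝓘(ℝ, ℝ)) ∞ einv U)

include hε hUo he0 hes heU hUe hie his in
/-- **The collar germ `Γ = κ⁻¹ ∘ e` and its extension to the open half cylinder.** With the
reference collar `κ = endCollar C` and its inverse `κ⁻¹ z = (inlBInv (proj z), height z)`, the
germ `Γ = κ⁻¹ ∘ e` along `M × {0}` is a collar germ (`CollarGerm`: smooth on a slab together with
the inverse germ `einv ∘ κ`, fixing `M × {0}` pointwise since `e (m, 0) = κ (m, 0) = inl m`, its
height extended two-sidedly by Seeley's theorem `exists_contMDiff_eq_on_slab`), so by the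
uniqueness of collars in germ form (`CollarGerm.exists_extension`) there is a bijection `S` of
`M × (0, ∞)`, smooth with smooth inverse, with `S = Γ` on `M × (0, a₂]`, `S = id` on
`M × [a₁, ∞)`, `0 < a₂ < a₁ < δ ≤ ε / 2`. Bröcker–Jänich (1982), (13.7).
[cite: BrockerJanich1982, (13.7)] -/
theorem exists_collar_germ_extension :
    ∃ (Smap Sinv : M × ℝ → M × ℝ) (a₁ a₂ δ : ℝ), 0 < a₂ ∧ a₂ < a₁ ∧ a₁ < δ ∧ δ ≤ ε ∧
      ContMDiffOn ((𝓡 n).prod 𝓘(ℝ, ℝ)) ((𝓡 n).prod 𝓘(ℝ, ℝ)) ∞ Smap (univ ×ˢ Ioi 0) ∧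
      ContMDiffOn ((𝓡 n).prod 𝓘(ℝ, ℝ)) ((𝓡 n).prod 𝓘(ℝ, ℝ)) ∞ Sinv (univ ×ˢ Ioi 0) ∧
      MapsTo Smap (univ ×ˢ Ioi (0 : ℝ)) (univ ×ˢ Ioi (0 : ℝ)) ∧
      MapsTo Sinv (univ ×ˢ Ioi (0 : ℝ)) (univ ×ˢ Ioi (0 : ℝ)) ∧
      (∀ q ∈ (univ : Set M) ×ˢ Ioi (0 : ℝ), Sinv (Smap q) = q) ∧
      (∀ q ∈ (univ : Set M) ×ˢ Ioi (0 : ℝ), Smap (Sinv q) = q) ∧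
      (∀ m, ∀ t ∈ Ioc 0 a₂, Smap (m, t) =
        (X.inlBInv (C.proj (e (m, t))), C.height (e (m, t)))) ∧
      (∀ q ∈ (univ : Set M) ×ˢ Ici a₁, Smap q = q) ∧
      (∀ m, ∀ t ∈ Ico 0 δ, e (m, t) ∈ C.regionOver X.inlPart ∧ X.endCollar C m t ∈ U) := by
  obtain ⟨δ₁, hδ₁, hδ₁ε, hslab⟩ := X.exists_slab_collar C hε hUo he0 hes heU
  -- the germ and the inverse germ
  set Γ : M × ℝ → M × ℝ := fun q => (X.inlBInv (C.proj (e q)), C.height (e q)) with hΓ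
  set Ψ : M × ℝ → M × ℝ := fun q => einv (uncurry (X.endCollar C) q) with hΨ
  -- smoothness on the slab of width `δ₁`
  have hsubε : (univ : Set M) ×ˢ Ico 0 δ₁ ⊆ (univ : Set M) ×ˢ Ico 0 ε :=
    prod_mono Subset.rfl (Ico_subset_Ico_right hδ₁ε)
  have hκ : ContMDiffOn ((𝓡 n).prod 𝓘(ℝ, ℝ)) (𝓡∂ (n + 1)) ∞ (uncurry (X.endCollar C))
      ((univ : Set M) ×ˢ Ico 0 δ₁) :=
    (X.contMDiffOn_endCollar C).mono (prod_mono Subset.rfl fun _ ht => ht.1)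
  have hΓs : ContMDiffOn ((𝓡 n).prod 𝓘(ℝ, ℝ)) ((𝓡 n).prod 𝓘(ℝ, ℝ)) ∞ Γ
      ((univ : Set M) ×ˢ Ico 0 δ₁) := by
    refine (X.contMDiffOn_inlBInv_proj C).comp (hes.mono hsubε) ?_
    rintro ⟨m, t⟩ ⟨-, ht⟩
    exact (hslab m t ht).1
  have hΨs : ContMDiffOn ((𝓡 n).prod 𝓘(ℝ, ℝ)) ((𝓡 n).prod 𝓘(ℝ, ℝ)) ∞ Ψ
      ((univ : Set M) ×ˢ Ico 0 δ₁) := by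
    refine his.comp hκ ?_
    rintro ⟨m, t⟩ ⟨-, ht⟩
    exact (hslab m t ht).2
  -- two-sided extension of the height (Seeley)
  have hgs : ContMDiffOn ((𝓡 n).prod 𝓘(ℝ, ℝ)) 𝓘(ℝ, ℝ) ∞ (fun q => (Γ q).2)
      ((univ : Set M) ×ˢ Ico 0 δ₁) :=
    contMDiff_snd.comp_contMDiffOn hΓs
  obtain ⟨H, hH, hHeq⟩ := exists_contMDiff_eq_on_slab (I := 𝓡 n) hδ₁ hgs
  -- values at the bottom
  have hΓ0 : ∀ m, Γ (m, 0) = (m, 0) := by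
    intro m
    change (X.inlBInv (C.proj (e (m, 0))), C.height (e (m, 0))) = (m, 0)
    rw [he0 m, ← X.endCollar_zero C m]
    exact X.inlBInv_proj_endCollar C m le_rfl
  have hΨ0 : ∀ m, Ψ (m, 0) = (m, 0) := by
    intro m
    change einv (X.endCollar C m 0) = (m, 0)
    rw [X.endCollar_zero, ← he0 m]
    exact hie (m, 0) ⟨mem_univ _, le_rfl, hε⟩
  -- the inverse relations
  have hΨΓ : ∀ m, ∀ t ∈ Ico 0 δ₁, Ψ (Γ (m, t)) = (m, t) := by
    intro m t ht
    have hz := (hslab m t ht).1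
    change einv (X.endCollar C (X.inlBInv (C.proj (e (m, t)))) (C.height (e (m, t)))) = (m, t)
    rw [X.endCollar_inlBInv_proj C hz]
    exact hie (m, t) (hsubε ⟨mem_univ _, ht⟩)
  have hΓΨ : ∀ m, ∀ t ∈ Ico 0 δ₁, Γ (Ψ (m, t)) = (m, t) := by
    intro m t ht
    have hz := (hslab m t ht).2
    change (X.inlBInv (C.proj (e (einv (X.endCollar C m t)))),
      C.height (e (einv (X.endCollar C m t)))) = (m, t)
    rw [(hUe _ hz).2]
    exact X.inlBInv_proj_endCollar C m ht.1
  -- the collar germ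
  have hδ2 : 0 < δ₁ / 2 := half_pos hδ₁
  have hsub : (univ : Set M) ×ˢ Ico 0 (δ₁ / 2) ⊆ (univ : Set M) ×ˢ Ico 0 δ₁ :=
    prod_mono Subset.rfl (Ico_subset_Ico_right (half_le_self hδ₁.le))
  let Cg : CollarGerm n M :=
    { Γ := Γ
      Ψ := Ψ
      height := H
      δ := δ₁ / 2
      δ_pos := hδ2
      contMDiffOn_Γ := hΓs.mono hsub
      contMDiffOn_Ψ := hΨs.mono hsub
      contMDiff_height := hH
      Γ_zero := hΓ0
      Ψ_zero := hΨ0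
      Γ_snd_nonneg := fun m t ht =>
        C.height_nonneg _ (hslab m t ⟨ht.1, ht.2.trans_le (half_le_self hδ₁.le)⟩).1.1
      Ψ_snd_nonneg := fun m t ht =>
        (hUe _ (hslab m t ⟨ht.1, ht.2.trans_le (half_le_self hδ₁.le)⟩).2).1.2.1
      Ψ_Γ := fun m t ht _ => hΨΓ m t ⟨ht.1, ht.2.trans_le (half_le_self hδ₁.le)⟩
      Γ_Ψ := fun m t ht _ => hΓΨ m t ⟨ht.1, ht.2.trans_le (half_le_self hδ₁.le)⟩
      height_eq := fun m t ht => hHeq m t ht }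
  obtain ⟨Smap, Sinv, a₁, a₂, ha₂, ha₂₁, ha₁δ, hS, hSi, hmS, hmSi, hl, hr, hbot, htop⟩ :=
    Cg.exists_extension
  refine ⟨Smap, Sinv, a₁, a₂, δ₁ / 2, ha₂, ha₂₁, ha₁δ, (half_le_self hδ₁.le).trans hδ₁ε, hS, hSi,
    hmS, hmSi, hl, hr, fun m t ht => ?_, htop,
    fun m t ht => hslab m t ⟨ht.1, ht.2.trans_le (half_le_self hδ₁.le)⟩⟩
  exact (hbot (m, t) ⟨mem_univ _, ht⟩).1

end Germ

/-! ### §3 The matching diffeomorphism -/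

/-- **Matching a collar of the incoming end to the reference collar.**  Let `X` be a cobordism
from `M` to `N`, `C` an open collar of `∂X` with end collar `κ = X.endCollar C`, and let
`e : M × ℝ → X.W` be smooth on the slab `M × [0, ε)`, with `e (m, 0) = inl m`, carrying the slab
into an open set `U` on which `einv` is a smooth inverse of `e` with values in the slab (so `e`
is a collar of the incoming end onto the open set `U`).  Then there is a self-diffeomorphism `Ψ`
of `X.W` fixing `inl M` and `inr N` pointwise with `Ψ (e (m, t)) = κ (m, t)` for all `m` and all
`t ∈ [0, δ)`, for some `δ ∈ (0, ε]`.  Proof: §2 gives the collar germ `Γ = κ⁻¹ ∘ e` and its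
extension `S`; `Ψ` is `κ ∘ S⁻¹ ∘ κ⁻¹` on the collar region of positive height over the incoming
part and the identity elsewhere.  Near `inl M` it equals `κ ∘ einv` (smooth on `U`), on the open
collar region it is a conjugate of `S⁻¹`, and off the compact `κ (M × [0, a₁])` it is the
identity; the inverse `κ ∘ S ∘ κ⁻¹` equals `e ∘ κ⁻¹` near `inl M`.  This is the uniqueness of
collars (Bröcker–Jänich (1982), (13.7); Hirsch (1976), Ch. 8 §1, Thm. 1.8) in the ambient,
relative form. [cite: BrockerJanich1982, (13.7)] [cite: HirschDT1976, Ch. 8 §1, Thm. 1.8] -/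
theorem exists_diffeomorph_comp_collar_eq_endCollar [IsManifold (𝓡 n) ∞ M]
    (C : X.bdry.OpenCollar) {ε : ℝ} (hε : 0 < ε) (e : M × ℝ → X.W) (einv : X.W → M × ℝ)
    (U : Set X.W) (hUo : IsOpen U) (he0 : ∀ m, e (m, 0) = X.inl m)
    (hes : ContMDiffOn ((𝓡 n).prod 𝓘(ℝ, ℝ)) (𝓡∂ (n + 1)) ∞ e (univ ×ˢ Ico 0 ε))
    (heU : MapsTo e (univ ×ˢ Ico (0 : ℝ) ε) U)
    (hUe : ∀ z ∈ U, einv z ∈ (univ : Set M) ×ˢ Ico (0 : ℝ) ε ∧ e (einv z) = z)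
    (hie : ∀ q ∈ (univ : Set M) ×ˢ Ico (0 : ℝ) ε, einv (e q) = q)
    (his : ContMDiffOn (𝓡∂ (n + 1)) ((𝓡 n).prod 𝓘(ℝ, ℝ)) ∞ einv U) :
    ∃ Ψ : X.W ≃ₘ⟮𝓡∂ (n + 1), 𝓡∂ (n + 1)⟯ X.W, (∀ y, Ψ (X.inr y) = X.inr y) ∧
      (∀ m, Ψ (X.inl m) = X.inl m) ∧
      ∃ δ, 0 < δ ∧ δ ≤ ε ∧ ∀ m, ∀ t ∈ Ico 0 δ, Ψ (e (m, t)) = X.endCollar C m t := by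
  classical
  rcases isEmpty_or_nonempty M with hM | hM
  · exact ⟨Diffeomorph.refl _ X.W ∞, fun y => rfl, fun m => (IsEmpty.false m).elim, ε, hε,
      le_rfl, fun m => (IsEmpty.false m).elim⟩
  haveI : CompactSpace M := X.compactSpace_of_inl
  obtain ⟨Smap, Sinv, a₁, a₂, δ, ha₂, ha₂₁, ha₁δ, hδε, hS, hSi, hmS, hmSi, hl, hr, hbot, htop,
    hslab⟩ := X.exists_collar_germ_extension C hε hUo he0 hes heU hUe hie his
  have ha₁ : 0 < a₁ := ha₂.trans ha₂₁
  have ha₂ε : a₂ < ε := (ha₂₁.trans ha₁δ).trans_le hδε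
  -- `S⁻¹ = id` above the level `a₁` as well
  have htop' : ∀ q ∈ (univ : Set M) ×ˢ Ici a₁, Sinv q = q := by
    intro q hq
    have hq' : q ∈ (univ : Set M) ×ˢ Ioi (0 : ℝ) := ⟨mem_univ _, ha₁.trans_le hq.2⟩
    conv_lhs => rw [← htop q hq]
    exact hl q hq'
  -- `e = κ ∘ Γ` on the slab, and `Γ` has positive height off the bottom
  have heΓ : ∀ m, ∀ t ∈ Ico 0 δ,
      X.endCollar C (X.inlBInv (C.proj (e (m, t)))) (C.height (e (m, t))) = e (m, t) :=
    fun m t ht => X.endCollar_inlBInv_proj C (hslab m t ht).1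
  -- the two maps
  set Upos : Set X.W := {z | z ∈ C.regionOver X.inlPart ∧ 0 < C.height z} with hUpos
  have hUposo : IsOpen Upos := X.isOpen_regionOver_inter_height_pos C
  set Ψf : X.W → X.W := fun z =>
    if z ∈ Upos then uncurry (X.endCollar C) (Sinv (X.inlBInv (C.proj z), C.height z)) else z
    with hΨf
  set Ψi : X.W → X.W := fun z =>
    if z ∈ Upos then uncurry (X.endCollar C) (Smap (X.inlBInv (C.proj z), C.height z)) else z
    with hΨi
  have Ψf_pos : ∀ z ∈ Upos,
      Ψf z = uncurry (X.endCollar C) (Sinv (X.inlBInv (C.proj z), C.height z)) :=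
    fun z hz => by rw [hΨf]; exact if_pos hz
  have Ψf_neg : ∀ z ∉ Upos, Ψf z = z := fun z hz => by rw [hΨf]; exact if_neg hz
  have Ψi_pos : ∀ z ∈ Upos,
      Ψi z = uncurry (X.endCollar C) (Smap (X.inlBInv (C.proj z), C.height z)) :=
    fun z hz => by rw [hΨi]; exact if_pos hz
  have Ψi_neg : ∀ z ∉ Upos, Ψi z = z := fun z hz => by rw [hΨi]; exact if_neg hz
  -- mutual inverses
  have hfi : ∀ z, Ψi (Ψf z) = z := by
    intro z
    by_cases hz : z ∈ Upos
    · rw [Ψf_pos z hz, Ψi_pos _ (X.endCollar_conj_mem C hmSi hz)]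
      exact X.endCollar_conj_conj C hmSi hr hz
    · rw [Ψf_neg z hz, Ψi_neg z hz]
  have hif : ∀ z, Ψf (Ψi z) = z := by
    intro z
    by_cases hz : z ∈ Upos
    · rw [Ψi_pos z hz, Ψf_pos _ (X.endCollar_conj_mem C hmS hz)]
      exact X.endCollar_conj_conj C hmS hl hz
    · rw [Ψi_neg z hz, Ψf_neg z hz]
  -- `Ψf ∘ e = κ` and `Ψi ∘ κ = e` on the slab of height `< a₂`
  have hVf : ∀ m, ∀ t ∈ Ico 0 a₂, Ψf (e (m, t)) = X.endCollar C m t := by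
    intro m t ht
    have htδ : t ∈ Ico 0 δ := ⟨ht.1, ht.2.trans (ha₂₁.trans ha₁δ)⟩
    rcases ht.1.eq_or_lt with rfl | htpos
    · rw [he0 m, Ψf_neg _ (X.inl_not_mem_regionOver_inter_height_pos C m), X.endCollar_zero]
    · have hmt : ((m, t) : M × ℝ) ∈ (univ : Set M) ×ˢ Ioi (0 : ℝ) := ⟨mem_univ _, htpos⟩
      have hb := hbot m t ⟨htpos, ht.2.le⟩
      have hpos : 0 < C.height (e (m, t)) := by
        have h := Set.mem_Ioi.1 (hmS hmt).2
        rwa [hb] at h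
      have hzU : e (m, t) ∈ Upos := ⟨(hslab m t htδ).1, hpos⟩
      rw [Ψf_pos _ hzU, ← hb, hl (m, t) hmt]
      rfl
  have hVi : ∀ m, ∀ t ∈ Ico 0 a₂, Ψi (X.endCollar C m t) = e (m, t) := by
    intro m t ht
    have htδ : t ∈ Ico 0 δ := ⟨ht.1, ht.2.trans (ha₂₁.trans ha₁δ)⟩
    rcases ht.1.eq_or_lt with rfl | htpos
    · rw [X.endCollar_zero, Ψi_neg _ (X.inl_not_mem_regionOver_inter_height_pos C m), he0 m]
    · have hzU : X.endCollar C m t ∈ Upos :=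
        ⟨X.endCollar_mem_regionOver C m ht.1, by
          show 0 < C.height (X.endCollar C m t)
          rwa [X.height_endCollar C m ht.1]⟩
      rw [Ψi_pos _ hzU, X.inlBInv_proj_endCollar C m ht.1, hbot m t ⟨htpos, ht.2.le⟩]
      exact heΓ m t htδ
  -- smoothness of `Ψf`
  have hBo : IsOpen ((uncurry (X.endCollar C)) '' ((univ : Set M) ×ˢ Icc 0 a₁))ᶜ :=
    (X.isCompact_image_endCollar C a₁).isClosed.isOpen_compl
  have hκs : ContMDiffOn ((𝓡 n).prod 𝓘(ℝ, ℝ)) (𝓡∂ (n + 1)) ∞ (uncurry (X.endCollar C))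
      ((univ : Set M) ×ˢ Ici 0) := X.contMDiffOn_endCollar C
  have hcf : ContMDiff (𝓡∂ (n + 1)) (𝓡∂ (n + 1)) ∞ Ψf := by
    intro z
    rcases X.mem_regionOver_pos_or C a₁ z with hz | ⟨m, rfl⟩ | hz
    · have heq : Ψf =ᶠ[𝓝 z]
          fun z => uncurry (X.endCollar C) (Sinv (X.inlBInv (C.proj z), C.height z)) := by
        filter_upwards [hUposo.mem_nhds hz] with w hw
        exact Ψf_pos w hw
      exact ((X.contMDiffOn_endCollar_conj C hSi hmSi).contMDiffAt
        (hUposo.mem_nhds hz)).congr_of_eventuallyEq heq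
    · -- near `inl m`, `Ψf = κ ∘ einv`
      set O : Set X.W := U ∩ einv ⁻¹' ((univ : Set M) ×ˢ Iio a₂) with hO
      have hOo : IsOpen O := his.continuousOn.isOpen_inter_preimage hUo (isOpen_univ.prod isOpen_Iio)
      have hmU : X.inl m ∈ U := by
        rw [← he0 m]; exact heU ⟨mem_univ _, le_rfl, hε⟩
      have hmO : X.inl m ∈ O := by
        refine ⟨hmU, ?_⟩
        change einv (X.inl m) ∈ (univ : Set M) ×ˢ Iio a₂
        rw [← he0 m, hie (m, 0) ⟨mem_univ _, le_rfl, hε⟩]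
        exact ⟨mem_univ _, ha₂⟩
      have heq : Ψf =ᶠ[𝓝 (X.inl m)] fun w => uncurry (X.endCollar C) (einv w) := by
        filter_upwards [hOo.mem_nhds hmO] with w hw
        obtain ⟨⟨-, h0, -⟩, hew⟩ := hUe w hw.1
        have h := hVf (einv w).1 (einv w).2 ⟨h0, hw.2.2⟩
        rw [Prod.mk.eta, hew] at h
        exact h
      have hsm : ContMDiffOn (𝓡∂ (n + 1)) (𝓡∂ (n + 1)) ∞
          (fun w => uncurry (X.endCollar C) (einv w)) U :=
        hκs.comp his fun w hw => ⟨mem_univ _, (hUe w hw).1.2.1⟩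
      exact (hsm.contMDiffAt (hUo.mem_nhds hmU)).congr_of_eventuallyEq heq
    · have heq : Ψf =ᶠ[𝓝 z] id := by
        filter_upwards [hBo.mem_nhds hz] with w hw
        by_cases hwU : w ∈ Upos
        · rw [Ψf_pos w hwU]
          exact X.endCollar_conj_eq_self C htop' hwU hw
        · exact Ψf_neg w hwU
      exact contMDiffAt_id.congr_of_eventuallyEq heq
  -- smoothness of `Ψi`
  have hci : ContMDiff (𝓡∂ (n + 1)) (𝓡∂ (n + 1)) ∞ Ψi := by
    intro z
    rcases X.mem_regionOver_pos_or C a₁ z with hz | ⟨m, rfl⟩ | hz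
    · have heq : Ψi =ᶠ[𝓝 z]
          fun z => uncurry (X.endCollar C) (Smap (X.inlBInv (C.proj z), C.height z)) := by
        filter_upwards [hUposo.mem_nhds hz] with w hw
        exact Ψi_pos w hw
      exact ((X.contMDiffOn_endCollar_conj C hS hmS).contMDiffAt
        (hUposo.mem_nhds hz)).congr_of_eventuallyEq heq
    · -- near `inl m`, `Ψi = e ∘ κ⁻¹`
      set V : Set X.W := {z | z ∈ C.regionOver X.inlPart ∧ C.height z < a₂} with hV
      have hVo : IsOpen V := X.isOpen_regionOver_inter_height_lt C a₂
      have hmV : X.inl m ∈ V := by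
        refine ⟨C.incl_mem_regionOver X.inlPart (X.inlB_mem_inlPart m), ?_⟩
        show C.height (X.inl m) < a₂
        rw [← X.endCollar_zero C m, X.height_endCollar C m le_rfl]
        exact ha₂
      have heq : Ψi =ᶠ[𝓝 (X.inl m)] fun w => e (X.inlBInv (C.proj w), C.height w) := by
        filter_upwards [hVo.mem_nhds hmV] with w hw
        obtain ⟨m', t, ht0, rfl⟩ := X.exists_endCollar_eq_of_mem_regionOver C hw.1
        have hta : t < a₂ := by
          have h := hw.2
          change C.height (X.endCollar C m' t) < a₂ at h
          rwa [X.height_endCollar C m' ht0] at h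
        rw [hVi m' t ⟨ht0, hta⟩, X.inlBInv_proj_endCollar C m' ht0]
      have hsm : ContMDiffOn (𝓡∂ (n + 1)) (𝓡∂ (n + 1)) ∞
          (fun w => e (X.inlBInv (C.proj w), C.height w)) V := by
        refine hes.comp ((X.contMDiffOn_inlBInv_proj C).mono fun w hw => hw.1) fun w hw => ?_
        exact ⟨mem_univ _, C.height_nonneg w hw.1.1, hw.2.trans ha₂ε⟩
      exact (hsm.contMDiffAt (hVo.mem_nhds hmV)).congr_of_eventuallyEq heq
    · have heq : Ψi =ᶠ[𝓝 z] id := by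
        filter_upwards [hBo.mem_nhds hz] with w hw
        by_cases hwU : w ∈ Upos
        · rw [Ψi_pos w hwU]
          exact X.endCollar_conj_eq_self C htop hwU hw
        · exact Ψi_neg w hwU
      exact contMDiffAt_id.congr_of_eventuallyEq heq
  -- assemble
  refine ⟨{ toFun := Ψf
            invFun := Ψi
            left_inv := hfi
            right_inv := hif
            contMDiff_toFun := hcf
            contMDiff_invFun := hci }, fun y => ?_, fun m => ?_, a₂, ha₂, ha₂ε.le,
    fun m t ht => hVf m t ht⟩
  · exact Ψf_neg _ (X.inr_not_mem_regionOver_inter_height_pos C y)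
  · exact Ψf_neg _ (X.inl_not_mem_regionOver_inter_height_pos C m)

/-- **Any two collars of the incoming end are matched by a diffeomorphism fixing the ends.**
For two collars `e₁`, `e₂ : M × [0, εᵢ) → X.W` of the incoming end (explicit data as in
`exists_diffeomorph_comp_collar_eq_endCollar`) there is a self-diffeomorphism `Ψ` of `X.W`
fixing `inl M` and `inr N` pointwise with `Ψ (e₁ (m, t)) = e₂ (m, t)` for `t ∈ [0, δ)`, some
`δ > 0` with `δ ≤ ε₁`, `δ ≤ ε₂`: match both to the reference collar of an open collar of `∂X`
(`BoundaryData.nonempty_openCollar`) and compose.  Bröcker–Jänich (1982), (13.7) (uniqueness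
of collars); Milnor (1965), Thm. 1.4 (uniqueness of the smooth structure on `W ∪_h W′` "up to a
diffeomorphism leaving `V₀`, `h(V₁) = V₁′`, and `V₂′` fixed").
[cite: BrockerJanich1982, (13.7)] [cite: MilnorHCobordism1965, §1, Thm. 1.4] -/
theorem exists_diffeomorph_comp_collar_eq_collar [IsManifold (𝓡 n) ∞ M]
    {ε₁ : ℝ} (hε₁ : 0 < ε₁) (e₁ : M × ℝ → X.W) (einv₁ : X.W → M × ℝ)
    (U₁ : Set X.W) (hU₁ : IsOpen U₁) (he₁0 : ∀ m, e₁ (m, 0) = X.inl m)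
    (he₁s : ContMDiffOn ((𝓡 n).prod 𝓘(ℝ, ℝ)) (𝓡∂ (n + 1)) ∞ e₁ (univ ×ˢ Ico 0 ε₁))
    (he₁U : MapsTo e₁ (univ ×ˢ Ico (0 : ℝ) ε₁) U₁)
    (hUe₁ : ∀ z ∈ U₁, einv₁ z ∈ (univ : Set M) ×ˢ Ico (0 : ℝ) ε₁ ∧ e₁ (einv₁ z) = z)
    (hie₁ : ∀ q ∈ (univ : Set M) ×ˢ Ico (0 : ℝ) ε₁, einv₁ (e₁ q) = q)
    (hi₁s : ContMDiffOn (𝓡∂ (n + 1)) ((𝓡 n).prod 𝓘(ℝ, ℝ)) ∞ einv₁ U₁)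
    {ε₂ : ℝ} (hε₂ : 0 < ε₂) (e₂ : M × ℝ → X.W) (einv₂ : X.W → M × ℝ)
    (U₂ : Set X.W) (hU₂ : IsOpen U₂) (he₂0 : ∀ m, e₂ (m, 0) = X.inl m)
    (he₂s : ContMDiffOn ((𝓡 n).prod 𝓘(ℝ, ℝ)) (𝓡∂ (n + 1)) ∞ e₂ (univ ×ˢ Ico 0 ε₂))
    (he₂U : MapsTo e₂ (univ ×ˢ Ico (0 : ℝ) ε₂) U₂)
    (hUe₂ : ∀ z ∈ U₂, einv₂ z ∈ (univ : Set M) ×ˢ Ico (0 : ℝ) ε₂ ∧ e₂ (einv₂ z) = z)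
    (hie₂ : ∀ q ∈ (univ : Set M) ×ˢ Ico (0 : ℝ) ε₂, einv₂ (e₂ q) = q)
    (hi₂s : ContMDiffOn (𝓡∂ (n + 1)) ((𝓡 n).prod 𝓘(ℝ, ℝ)) ∞ einv₂ U₂) :
    ∃ Ψ : X.W ≃ₘ⟮𝓡∂ (n + 1), 𝓡∂ (n + 1)⟯ X.W, (∀ y, Ψ (X.inr y) = X.inr y) ∧
      (∀ m, Ψ (X.inl m) = X.inl m) ∧
      ∃ δ, 0 < δ ∧ δ ≤ ε₁ ∧ δ ≤ ε₂ ∧ ∀ m, ∀ t ∈ Ico 0 δ, Ψ (e₁ (m, t)) = e₂ (m, t) := by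
  rcases isEmpty_or_nonempty M with hM | hM
  · exact ⟨Diffeomorph.refl _ X.W ∞, fun y => rfl, fun m => (IsEmpty.false m).elim, min ε₁ ε₂,
      lt_min hε₁ hε₂, min_le_left _ _, min_le_right _ _, fun m => (IsEmpty.false m).elim⟩
  haveI : CompactSpace M := X.compactSpace_of_inl
  haveI : Nonempty X.bdry.carrier := ⟨X.inlB (Classical.arbitrary M)⟩
  obtain ⟨C⟩ := X.bdry.nonempty_openCollar
  obtain ⟨Ψ₁, h₁r, h₁l, δ₁, hδ₁, hδ₁ε, h₁⟩ := X.exists_diffeomorph_comp_collar_eq_endCollar C hε₁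
    e₁ einv₁ U₁ hU₁ he₁0 he₁s he₁U hUe₁ hie₁ hi₁s
  obtain ⟨Ψ₂, h₂r, h₂l, δ₂, hδ₂, hδ₂ε, h₂⟩ := X.exists_diffeomorph_comp_collar_eq_endCollar C hε₂
    e₂ einv₂ U₂ hU₂ he₂0 he₂s he₂U hUe₂ hie₂ hi₂s
  refine ⟨Ψ₁.trans Ψ₂.symm, fun y => ?_, fun m => ?_, min δ₁ δ₂, lt_min hδ₁ hδ₂,
    (min_le_left _ _).trans hδ₁ε, (min_le_right _ _).trans hδ₂ε, fun m t ht => ?_⟩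
  · rw [Diffeomorph.coe_trans, comp_apply, h₁r]
    conv_lhs => rw [← h₂r y]
    exact Ψ₂.symm_apply_apply _
  · rw [Diffeomorph.coe_trans, comp_apply, h₁l]
    conv_lhs => rw [← h₂l m]
    exact Ψ₂.symm_apply_apply _
  · rw [Diffeomorph.coe_trans, comp_apply, h₁ m t ⟨ht.1, ht.2.trans_le (min_le_left _ _)⟩]
    conv_lhs => rw [← h₂ m t ⟨ht.1, ht.2.trans_le (min_le_right _ _)⟩]
    exact Ψ₂.symm_apply_apply _

end Cobordism

end Literature.Topology.FourManifolds

end
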